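import Summits.QuantumFields.BalabanUV.Beta.D1BFx.LamDictionary
import Summits.QuantumFields.BalabanUV.Beta.D1BFx.LamRowGlue
import Summits.QuantumFields.BalabanUV.Beta.D1BFx.LamPartnerZero

/-!
# `BalabanUV.Beta.D1BFx.RoadEndLamRow` — road «BF-x» for binder row D1, slot (K): **THE G_Λ ROW `hGrp gΛ` OF THE END OF RECORD
# `RoadEndBFxTotalShellGroups.d1Drift_BFx_total_shell_of_prop12_of_groups` (p252741) IS `≤ 0`** — the dictionary `LamDictionary.gLam_row_eq_lamWords` (gan24-leaf-05-g40,
# an3-g53's (DICT)) composed with the consumer glue `LamRowGlue.abs_gLam_row_le_zero_of_dict` (the census identities (I) `LamCoeffAffineNull`, (II) `LamFactor`, instance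
# `LamCoeffMoments` at `A := KInv`), MODULO the displayed letters of the two partner functionals `Nrν`, `Nrμ`: block covariance, exponential localisation, and the
# ZERO-MOMENTUM letter `hZero` (= `KernelWardInsertionZero.tsum_resp_eq_zero` under the local covariance letters (W1)∕(W2′), ρ-g9-13∕-20∕-21 — NOT discharged here)

## v1.1 (2026-08-21; `b2b-balaban-beta-d1-formalise-leaf-04` gen 8, owner ruling ρ-g9-25 «no further owner word needed») — APPEND-ONLY §2
The four partner letters and the two zero-momentum letters of v1 are FED BY NAME from the tree: `hNrν`∕`hNrμ` (exponential localisation) from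
`LamPartnerLetters.Nrν_decay`∕`Nrμ_decay` and `hcovν`∕`hcovμ` (block covariance) from `LamPartnerLetters.Nrν_cov`∕`Nrμ_cov` (gan24-leaf-05-g40, p254464), and
`hZeroν`∕`hZeroμ` from `LamPartnerZero.tsum_Nrν_eq_zero`∕`tsum_Nrμ_eq_zero` (leaf-04-g8, p255389) — theorems **`gLam_row_eq_zero_of_letters`** ∕
**`abs_gLam_row_le_zero_of_letters`**.  After v1.1 the DISPLAYED hypotheses of the G_Λ row are EXACTLY: `0 < a`, `Spr (Ga n a)`, the Λ-table envelope `hΛ`, the Λ₂-slot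
structure sockets `hdec` ∕ `hTloc` ∕ `hWAa` ∕ `hWAl`, the Λ₂-companion's block-covariance socket `hTcov`, `cΛ ≠ 0`, `ε = ±1`, the generator localisation `hX`, the local
covariance letter (W1) for `ε • SbfBal` against the leg `Ga`, the letter (W2′) for the scaled companion `−(ε·cΛ₂∕cΛ) • TΛ m 0` against `ffOf (hessFF n m 0)` (for every
`m`), and the fibre bookkeeping `hfib`.  Honest sentence for the records (owner, ρ-g9-25): «the G_Λ estimate row of road BF-x's END is a tree theorem modulo the local
covariance letter (W1) of the full first-order stencil against the leg `Ga`, the (W2′) letter for the Λ₂ companion `TΛ`, the generator-localisation `hX`, and the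
Λ₂-slot structure sockets».  Every v1 declaration byte-identical; one `import` added (`LamPartnerZero`).  0 wall binders discharged; (K) NOT closed; NOT D1,
NOT `BetaPertH`, NOT continuum, NOT Clay.

HONEST DEPENDENCY (cell records, verbatim): «continuum YM on T⁴ ⇐ BetaPertH ∧ nine spine estimates (0/9 proved); BetaPertH ⇐ (D1) ∧ (D4) ∧
CAP+tail; G-an2-4 gates asym, D1 and NE2/3/4.»  HONEST FRAMING (cell contract, verbatim): «discharging `BetaPertH` makes Bałaban's UV stability
UNCONDITIONAL — a real constructive-QFT result; it is NOT the continuum limit and NOT the Clay problem.»  THIS MODULE DISCHARGES NOTHING of the wall: it is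
[folklore] composition BY NAME.  What it does: ONE displayed estimate row of the road's END (`hGrp gΛ`, the Λ-sector rest words) is reduced to IDENTITIES plus the
covariance letters of the typed objects — the row's constant is `0`.  The Λ₂-slot structure sockets (`hdec`, `hTloc`, `hWAa`, `hWAl`), the partner letters and `hfib` stay
DISPLAYED.  No definition, no `def … : Prop`, nothing cited, 0 sorry.  Root-level binders hW ∕ hR-sockets ∕ hSX-socket ∕ D1Tel ∕ D1Rep — 0 discharged; (K) NOT closed;
NOT D1, NOT BetaPertH, NOT continuum, NOT Clay.

ABSOLUTE RULE (cell charter, verbatim): «No internally-minted statement may enter as a cited fact. Every hypothesis is either kernel-proved in this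
package or a verbatim quotation of a PUBLISHED theorem with page reference. The manuscript(s) under audit are NOT citable for their own disputed
steps — they are the thing under adjudication; programme-internal (2001/route/tribunal) claims are never citable.»

Unit `b2b-balaban-beta-d1-p2` (road owner, gen 9); `K-CLOSURE-PLAN-R1L.md` §8 (ρ-g9-16), `K-END-RESHAPE-GROUPS.md` §3.
-/

noncomputable section

open Finset Filter Topology
open scoped BigOperators
open Literature.MathematicalPhysics.QuantumFieldTheory.Balaban1983to89
open Literature.MathematicalPhysics.QuantumFieldTheory.Balaban1983to89.Beta
open B12Sec2to5 (l1)
open ExpKernelCalculus (Site MKer BiLoc)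
open DyadicShell (Pt)
open WindowIdentification (fullSum)
open DressedMomentNormalisation (resSite)
open OneStepResolventKernel (Fib KInv)
open InterLevelTransport (onLat)
open BalabanStepJets (lamCoeffOf)
open Summit.QuantumFields.BalabanUV.Beta.TameKernelCalculus (Spr Loc trK)
open Summit.QuantumFields.BalabanUV.Beta.D1BFx.GluonLeg (Ga)
open Summit.QuantumFields.BalabanUV.Beta.D1BFx.ReducedKernel (TableR)
open Summit.QuantumFields.BalabanUV.Beta.D1BFx.FrozenLegProfile (gfrz)
open Summit.QuantumFields.BalabanUV.Beta.D1BFx.SplitInstance (RestIdx)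
open Summit.QuantumFields.BalabanUV.Beta.D1BFx.SplitRecut (restK')
open Summit.QuantumFields.BalabanUV.Beta.D1BFx.LamGroupPointwise (lamFibre)
open Summit.QuantumFields.BalabanUV.Beta.D1BFx.LamDictionary (Nrν Nrμ gLam_row_eq_lamWords)
open Summit.QuantumFields.BalabanUV.Beta.D1BFx.LamRowGlue (abs_gLam_row_le_zero_of_dict gLam_row_eq_zero_of_dict)

namespace Summit.QuantumFields.BalabanUV.Beta.D1BFx.RoadEndLamRow

variable (n : ℕ) [NeZero n] (a : ℝ) (cE cVH cΛ cR cK cQ cE₂ cJ4 cΛ₂ cR₂ cQ₂ x₀ : ℝ) (WE WJ WΛ WR WQ : TableR) (ωgl ωgh lam N : ℝ)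
  {TΛ WA : Fin 4 → Site 4 → Fin 4 → Site 4 → MKer 4 (Fin 4)} {CT δT : ℝ} (μ ν : Fin 4)

/-- [folklore] **THE G_Λ ROW OF THE END IS ZERO, MODULO THE PARTNER LETTERS** — at every blocking `n`: the Λ-sector rest words of `RoadEndBFxTotalShellGroups`' row
`hGrp gΛ` (45 bubble words with a Λ-vertex + the 3 Λ₂-slot tadpole words, `hfib`) have base-point-averaged (1.22)-moment EXACTLY `0`, given (i) the Λ₂-slot structure
sockets of the dictionary (`hdec`, `hTloc`, `hWAa`, `hWAl`), (ii) block covariance and exponential localisation of the two partner functionals `Nrν`, `Nrμ`, and (iii) their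
ZERO-MOMENTUM letters `hZeroν`, `hZeroμ` (`Σ'_{u′} Nr m 0 u′ = 0` — the consumer of `KernelWardInsertionZero.tsum_resp_eq_zero` under (W1)∕(W2′); displayed, NOT proved here). -/
theorem gLam_row_eq_zero (ha : 0 < a) (hGa : Spr (Ga n a)) {CΛt δW : ℝ} (hδW : 0 < δW) (hΛ : ∀ κ u l u', BiLoc (WΛ κ u l u') u u' CΛt δW)
    (hδT : 0 < δT)
    (hdec : ∀ κ u l u', WΛ κ u l u' =
      (∑ m : Fin 4, OneStepResolventKernel.wsum (onLat n (fun y => lamCoeffOf (KInv (N := n) (d := 3)) n m y l u'))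
          (fun v => onLat n (fun y => TΛ m y κ u) v))
      + (∑ m : Fin 4, OneStepResolventKernel.wsum (onLat n (fun y => lamCoeffOf (KInv (N := n) (d := 3)) n m y κ u))
          (fun v => onLat n (fun y => TΛ m y l u') v))
      + WA κ u l u')
    (hTloc : ∀ m y κ u, BiLoc (TΛ m y κ u) ((n : ℤ) • y) ((n : ℤ) • y) (CT * Real.exp (-δT * l1 ((n : ℤ) • y - u))) δT)
    (hWAa : ∀ κ u l u', trK (WA κ u l u') = -WA κ u l u') (hWAl : ∀ κ u l u', Loc (WA κ u l u'))
    {Cν δν Cμ δμ : ℝ} (hδν : 0 < δν) (hδμ : 0 < δμ)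
    (hNrν : ∀ m y u, |Nrν n a cE cVH cΛ cR cK cQ cΛ₂ ωgl TΛ μ m y u| ≤ Cν * Real.exp (-δν * l1 ((n : ℤ) • y - u)))
    (hNrμ : ∀ m y u, |Nrμ n a cE cVH cΛ cR cK cQ cΛ₂ ωgl TΛ ν m y u| ≤ Cμ * Real.exp (-δμ * l1 ((n : ℤ) • y - u)))
    (hcovν : ∀ m y t u', Nrν n a cE cVH cΛ cR cK cQ cΛ₂ ωgl TΛ μ m (y + t) (u' + (n : ℤ) • t) = Nrν n a cE cVH cΛ cR cK cQ cΛ₂ ωgl TΛ μ m y u')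
    (hcovμ : ∀ m y t u', Nrμ n a cE cVH cΛ cR cK cQ cΛ₂ ωgl TΛ ν m (y + t) (u' + (n : ℤ) • t) = Nrμ n a cE cVH cΛ cR cK cQ cΛ₂ ωgl TΛ ν m y u')
    (hZeroν : ∀ m : Fin 4, ∑' u' : Site 4, Nrν n a cE cVH cΛ cR cK cQ cΛ₂ ωgl TΛ μ m 0 u' = 0)
    (hZeroμ : ∀ m : Fin 4, ∑' u' : Site 4, Nrμ n a cE cVH cΛ cR cK cQ cΛ₂ ωgl TΛ ν m 0 u' = 0)
    {G : Type*} [Fintype G] [DecidableEq G] {grp : RestIdx → G} {gΛ : G}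
    (hfib : (univ : Finset RestIdx).filter (fun τ => grp τ = gΛ) = lamFibre) :
    ∑ b ∈ (univ : Finset (Fin 4 → Fin n)).image resSite, ((n : ℝ) ^ 4)⁻¹ *
        fullSum (fun w : Pt => ∑ τ ∈ (univ : Finset RestIdx).filter (fun τ => grp τ = gΛ),
          restK' n a (gfrz n a b) cE cΛ cR cK cQ cE₂ cJ4 cΛ₂ cR₂ cQ₂ x₀ WE WJ WΛ WR WQ ωgl ωgh lam N μ ν b τ w) = 0 :=
  gLam_row_eq_zero_of_dict (N := n) (d := 3) μ ν _
    (Nrν n a cE cVH cΛ cR cK cQ cΛ₂ ωgl TΛ μ) (Nrμ n a cE cVH cΛ cR cK cQ cΛ₂ ωgl TΛ ν) hδν hδμ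
    (gLam_row_eq_lamWords n a cE cVH cΛ cR cK cQ cE₂ cJ4 cΛ₂ cR₂ cQ₂ x₀ WE WJ WΛ WR WQ ωgl ωgh lam N μ ν ha hGa hδW hΛ hδT hdec hTloc hWAa hWAl
      hδν hδμ hNrν hNrμ hcovμ hfib)
    hcovν hNrν hZeroν hcovμ hNrμ hZeroμ

/-- [folklore] **THE SHAPE THE END CONSUMES**: `|row| ≤ 0` — i.e. the `g = gΛ` clause of `RoadEndBFxTotalShellGroups.d1Drift_BFx_total_shell_of_prop12_of_groups`'s `hGrp` with
`CG gΛ := 0`, modulo the displayed letters. -/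
theorem abs_gLam_row_le_zero (ha : 0 < a) (hGa : Spr (Ga n a)) {CΛt δW : ℝ} (hδW : 0 < δW) (hΛ : ∀ κ u l u', BiLoc (WΛ κ u l u') u u' CΛt δW)
    (hδT : 0 < δT)
    (hdec : ∀ κ u l u', WΛ κ u l u' =
      (∑ m : Fin 4, OneStepResolventKernel.wsum (onLat n (fun y => lamCoeffOf (KInv (N := n) (d := 3)) n m y l u'))
          (fun v => onLat n (fun y => TΛ m y κ u) v))
      + (∑ m : Fin 4, OneStepResolventKernel.wsum (onLat n (fun y => lamCoeffOf (KInv (N := n) (d := 3)) n m y κ u))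
          (fun v => onLat n (fun y => TΛ m y l u') v))
      + WA κ u l u')
    (hTloc : ∀ m y κ u, BiLoc (TΛ m y κ u) ((n : ℤ) • y) ((n : ℤ) • y) (CT * Real.exp (-δT * l1 ((n : ℤ) • y - u))) δT)
    (hWAa : ∀ κ u l u', trK (WA κ u l u') = -WA κ u l u') (hWAl : ∀ κ u l u', Loc (WA κ u l u'))
    {Cν δν Cμ δμ : ℝ} (hδν : 0 < δν) (hδμ : 0 < δμ)
    (hNrν : ∀ m y u, |Nrν n a cE cVH cΛ cR cK cQ cΛ₂ ωgl TΛ μ m y u| ≤ Cν * Real.exp (-δν * l1 ((n : ℤ) • y - u)))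
    (hNrμ : ∀ m y u, |Nrμ n a cE cVH cΛ cR cK cQ cΛ₂ ωgl TΛ ν m y u| ≤ Cμ * Real.exp (-δμ * l1 ((n : ℤ) • y - u)))
    (hcovν : ∀ m y t u', Nrν n a cE cVH cΛ cR cK cQ cΛ₂ ωgl TΛ μ m (y + t) (u' + (n : ℤ) • t) = Nrν n a cE cVH cΛ cR cK cQ cΛ₂ ωgl TΛ μ m y u')
    (hcovμ : ∀ m y t u', Nrμ n a cE cVH cΛ cR cK cQ cΛ₂ ωgl TΛ ν m (y + t) (u' + (n : ℤ) • t) = Nrμ n a cE cVH cΛ cR cK cQ cΛ₂ ωgl TΛ ν m y u')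
    (hZeroν : ∀ m : Fin 4, ∑' u' : Site 4, Nrν n a cE cVH cΛ cR cK cQ cΛ₂ ωgl TΛ μ m 0 u' = 0)
    (hZeroμ : ∀ m : Fin 4, ∑' u' : Site 4, Nrμ n a cE cVH cΛ cR cK cQ cΛ₂ ωgl TΛ ν m 0 u' = 0)
    {G : Type*} [Fintype G] [DecidableEq G] {grp : RestIdx → G} {gΛ : G}
    (hfib : (univ : Finset RestIdx).filter (fun τ => grp τ = gΛ) = lamFibre) :
    |∑ b ∈ (univ : Finset (Fin 4 → Fin n)).image resSite, ((n : ℝ) ^ 4)⁻¹ *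
        fullSum (fun w : Pt => ∑ τ ∈ (univ : Finset RestIdx).filter (fun τ => grp τ = gΛ),
          restK' n a (gfrz n a b) cE cΛ cR cK cQ cE₂ cJ4 cΛ₂ cR₂ cQ₂ x₀ WE WJ WΛ WR WQ ωgl ωgh lam N μ ν b τ w)| ≤ 0 := by
  rw [gLam_row_eq_zero n a cE cVH cΛ cR cK cQ cE₂ cJ4 cΛ₂ cR₂ cQ₂ x₀ WE WJ WΛ WR WQ ωgl ωgh lam N μ ν ha hGa hδW hΛ hδT hdec hTloc hWAa hWAl hδν hδμ
    hNrν hNrμ hcovν hcovμ hZeroν hZeroμ hfib, abs_zero]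


/-! ## §2 (v1.1) The partner letters and the zero-momentum letters FED BY NAME (`LamPartnerLetters` p254464, `LamPartnerZero` p255389; ρ-g9-25) -/

open ExpKernelCalculus (shiftK comp) in
open AveragingHessianKernels (hessFF) in
open KernelWard (divV) in
open Summit.QuantumFields.BalabanUV.Beta.D1BFx.FineStencilBF (ffOf) in
open Summit.QuantumFields.BalabanUV.Beta.D1BFx.FineStencilBFBalaban (SbfBal) in
open Summit.QuantumFields.BalabanUV.Beta.D1BFx.LamPartnerLetters (Nrν_cov Nrμ_cov Nrν_decay Nrμ_decay) in
open Summit.QuantumFields.BalabanUV.Beta.D1BFx.LamPartnerZero (tsum_Nrν_eq_zero tsum_Nrμ_eq_zero) in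
/-- [folklore] **THE G_Λ ROW OF THE END IS ZERO, MODULO THE COVARIANCE LETTERS (W1)∕(W2′), `hX`, `hTcov` AND THE Λ₂-SLOT SOCKETS** (v1.1) — v1's
`gLam_row_eq_zero` with its six partner-letter hypotheses discharged BY NAME: `hNrν`∕`hNrμ` := `LamPartnerLetters.Nrν_decay`∕`Nrμ_decay` (from `0 < a`, `Spr (Ga n a)`,
`hTloc`), `hcovν`∕`hcovμ` := `LamPartnerLetters.Nrν_cov`∕`Nrμ_cov` (from `0 < a` and the companion's block-covariance socket `hTcov`), `hZeroν`∕`hZeroμ` :=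
`LamPartnerZero.tsum_Nrν_eq_zero`∕`tsum_Nrμ_eq_zero` (from `cΛ ≠ 0`, `ε = ±1`, the generator localisation `hX`, the local covariance letter (W1) for `ε • SbfBal` against
`Ga`, and (W2′) for `−(ε·cΛ₂∕cΛ) • TΛ m 0` against `ffOf (hessFF n m 0)`, every `m`).  HONEST: composition BY NAME; (W1), (W2′), `hX`, `hTcov` and the Λ₂-slot sockets
`hdec`∕`hTloc`∕`hWAa`∕`hWAl` are DISPLAYED hypotheses, none is proved here; 0 wall binders discharged; (K) NOT closed; NOT D1, NOT `BetaPertH`. -/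
theorem gLam_row_eq_zero_of_letters (ha : 0 < a) (hGa : Spr (Ga n a)) {CΛt δW : ℝ} (hδW : 0 < δW) (hΛ : ∀ κ u l u', BiLoc (WΛ κ u l u') u u' CΛt δW)
    (hδT : 0 < δT)
    (hdec : ∀ κ u l u', WΛ κ u l u' =
      (∑ m : Fin 4, OneStepResolventKernel.wsum (onLat n (fun y => lamCoeffOf (KInv (N := n) (d := 3)) n m y l u'))
          (fun v => onLat n (fun y => TΛ m y κ u) v))
      + (∑ m : Fin 4, OneStepResolventKernel.wsum (onLat n (fun y => lamCoeffOf (KInv (N := n) (d := 3)) n m y κ u))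
          (fun v => onLat n (fun y => TΛ m y l u') v))
      + WA κ u l u')
    (hTloc : ∀ m y κ u, BiLoc (TΛ m y κ u) ((n : ℤ) • y) ((n : ℤ) • y) (CT * Real.exp (-δT * l1 ((n : ℤ) • y - u))) δT)
    (hWAa : ∀ κ u l u', trK (WA κ u l u') = -WA κ u l u') (hWAl : ∀ κ u l u', Loc (WA κ u l u'))
    -- the Λ₂-companion's block-covariance socket (feeds `hcov•` through `LamPartnerLetters.Nr•_cov`)
    (hTcov : ∀ m y κ u t, TΛ m (y + t) κ (u + (n : ℤ) • t) = shiftK (-((n : ℤ) • t)) (TΛ m y κ u))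
    -- the data of the zero-momentum letters (feed `hZero•` through `LamPartnerZero.tsum_Nr•_eq_zero`): `cΛ ≠ 0`, `ε = ±1`, `hX`, (W1), (W2′)
    (hcΛ : cΛ ≠ 0) {ε : ℝ} (hε : ε = 1 ∨ ε = -1) {X : Site 4 → MKer 4 (Fin 4)} {Cx δx : ℝ} (hδx : 0 < δx) (hX : ∀ u, BiLoc (X u) u u Cx δx)
    (hW1 : ∀ u, comp (comp (Ga n a) (divV (fun κ v => ε • SbfBal n a cE cVH cΛ cR cK cQ κ v) u)) (Ga n a) =
      comp (Ga n a) (X u) - comp (X u) (Ga n a))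
    (hW2 : ∀ (m : Fin 4) (u : Site 4),
      divV (fun κ v => (-(ε * (cΛ₂ / cΛ))) • TΛ m 0 κ v) u = comp (X u) (ffOf (hessFF n m 0)) - comp (ffOf (hessFF n m 0)) (X u))
    {G : Type*} [Fintype G] [DecidableEq G] {grp : RestIdx → G} {gΛ : G}
    (hfib : (univ : Finset RestIdx).filter (fun τ => grp τ = gΛ) = lamFibre) :
    ∑ b ∈ (univ : Finset (Fin 4 → Fin n)).image resSite, ((n : ℝ) ^ 4)⁻¹ *
        fullSum (fun w : Pt => ∑ τ ∈ (univ : Finset RestIdx).filter (fun τ => grp τ = gΛ),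
          restK' n a (gfrz n a b) cE cΛ cR cK cQ cE₂ cJ4 cΛ₂ cR₂ cQ₂ x₀ WE WJ WΛ WR WQ ωgl ωgh lam N μ ν b τ w) = 0 := by
  obtain ⟨Cν, δν, hδν, hNrν⟩ := Nrν_decay n cE cVH cΛ cR cK cQ cΛ₂ ωgl ha hGa hδT hTloc μ
  obtain ⟨Cμ, δμ, hδμ, hNrμ⟩ := Nrμ_decay n cE cVH cΛ cR cK cQ cΛ₂ ωgl ha hGa hδT hTloc ν
  exact gLam_row_eq_zero n a cE cVH cΛ cR cK cQ cE₂ cJ4 cΛ₂ cR₂ cQ₂ x₀ WE WJ WΛ WR WQ ωgl ωgh lam N μ ν ha hGa hδW hΛ hδT hdec hTloc hWAa hWAl hδν hδμ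
    hNrν hNrμ (Nrν_cov n a cE cVH cΛ cR cK cQ cΛ₂ ωgl ha hTcov μ) (Nrμ_cov n a cE cVH cΛ cR cK cQ cΛ₂ ωgl ha hTcov ν)
    (fun m => tsum_Nrν_eq_zero n cE cVH cΛ cR cK cQ cΛ₂ ωgl ha hGa hδT hTloc hcΛ hε hδx hX hW1 m (hW2 m) μ)
    (fun m => tsum_Nrμ_eq_zero n cE cVH cΛ cR cK cQ cΛ₂ ωgl ha hGa hδT hTloc hcΛ hε hδx hX hW1 m (hW2 m) ν) hfib

open ExpKernelCalculus (shiftK comp) in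
open AveragingHessianKernels (hessFF) in
open KernelWard (divV) in
open Summit.QuantumFields.BalabanUV.Beta.D1BFx.FineStencilBF (ffOf) in
open Summit.QuantumFields.BalabanUV.Beta.D1BFx.FineStencilBFBalaban (SbfBal) in
/-- [folklore] **THE SHAPE THE END CONSUMES** (v1.1): `|row| ≤ 0` — the `g = gΛ` clause of
`RoadEndBFxTotalShellGroups.d1Drift_BFx_total_shell_of_prop12_of_groups`'s `hGrp` with `CG gΛ := 0`, modulo exactly (W1), (W2′), `hX`, `hTcov`, `cΛ ≠ 0`, `ε = ±1`
and the Λ₂-slot structure sockets.  HONEST: composition BY NAME; 0 wall binders discharged; (K) NOT closed; NOT D1, NOT `BetaPertH`. -/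
theorem abs_gLam_row_le_zero_of_letters (ha : 0 < a) (hGa : Spr (Ga n a)) {CΛt δW : ℝ} (hδW : 0 < δW) (hΛ : ∀ κ u l u', BiLoc (WΛ κ u l u') u u' CΛt δW)
    (hδT : 0 < δT)
    (hdec : ∀ κ u l u', WΛ κ u l u' =
      (∑ m : Fin 4, OneStepResolventKernel.wsum (onLat n (fun y => lamCoeffOf (KInv (N := n) (d := 3)) n m y l u'))
          (fun v => onLat n (fun y => TΛ m y κ u) v))
      + (∑ m : Fin 4, OneStepResolventKernel.wsum (onLat n (fun y => lamCoeffOf (KInv (N := n) (d := 3)) n m y κ u))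
          (fun v => onLat n (fun y => TΛ m y l u') v))
      + WA κ u l u')
    (hTloc : ∀ m y κ u, BiLoc (TΛ m y κ u) ((n : ℤ) • y) ((n : ℤ) • y) (CT * Real.exp (-δT * l1 ((n : ℤ) • y - u))) δT)
    (hWAa : ∀ κ u l u', trK (WA κ u l u') = -WA κ u l u') (hWAl : ∀ κ u l u', Loc (WA κ u l u'))
    (hTcov : ∀ m y κ u t, TΛ m (y + t) κ (u + (n : ℤ) • t) = shiftK (-((n : ℤ) • t)) (TΛ m y κ u))
    (hcΛ : cΛ ≠ 0) {ε : ℝ} (hε : ε = 1 ∨ ε = -1) {X : Site 4 → MKer 4 (Fin 4)} {Cx δx : ℝ} (hδx : 0 < δx) (hX : ∀ u, BiLoc (X u) u u Cx δx)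
    (hW1 : ∀ u, comp (comp (Ga n a) (divV (fun κ v => ε • SbfBal n a cE cVH cΛ cR cK cQ κ v) u)) (Ga n a) =
      comp (Ga n a) (X u) - comp (X u) (Ga n a))
    (hW2 : ∀ (m : Fin 4) (u : Site 4),
      divV (fun κ v => (-(ε * (cΛ₂ / cΛ))) • TΛ m 0 κ v) u = comp (X u) (ffOf (hessFF n m 0)) - comp (ffOf (hessFF n m 0)) (X u))
    {G : Type*} [Fintype G] [DecidableEq G] {grp : RestIdx → G} {gΛ : G}
    (hfib : (univ : Finset RestIdx).filter (fun τ => grp τ = gΛ) = lamFibre) :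
    |∑ b ∈ (univ : Finset (Fin 4 → Fin n)).image resSite, ((n : ℝ) ^ 4)⁻¹ *
        fullSum (fun w : Pt => ∑ τ ∈ (univ : Finset RestIdx).filter (fun τ => grp τ = gΛ),
          restK' n a (gfrz n a b) cE cΛ cR cK cQ cE₂ cJ4 cΛ₂ cR₂ cQ₂ x₀ WE WJ WΛ WR WQ ωgl ωgh lam N μ ν b τ w)| ≤ 0 := by
  rw [gLam_row_eq_zero_of_letters n a cE cVH cΛ cR cK cQ cE₂ cJ4 cΛ₂ cR₂ cQ₂ x₀ WE WJ WΛ WR WQ ωgl ωgh lam N μ ν ha hGa hδW hΛ hδT hdec hTloc hWAa hWAl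
    hTcov hcΛ hε hδx hX hW1 hW2 hfib, abs_zero]

end Summit.QuantumFields.BalabanUV.Beta.D1BFx.RoadEndLamRow

end
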